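import Summits.QuantumAdvantage.QuantumAdvantage.Theorems.CubicForrelationNearExactIsExactTwelveLevelFiveOffHyperplaneAt2932
import Summits.QuantumAdvantage.QuantumAdvantage.Theorems.CubicForrelationNearExactIsExactTwelveLevelFiveDuality

/-!
# Crux `CubicForrelation.NearExactIsExact` (stmt-QuantumAdvantage-14043) — n = 12 AT `Φ = 29/32`: the level-5 configurations R2(a)
  (`±16` on four even points) and R2(b) (`±32` at one even point) are DEAD

Certificate seat `b2b-cforr-cert` (gen 23).  HONEST FRAMING: kernel-checked finite-slice lemmas (standard axioms, no `decide`) about cubic Boolean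
pairs on 12 bits; two of the three "not exact off `P`" configurations of `tw23_levelFive_ge2932_offP` are excluded, so a level-5 side at
`Φ ≥ 29/32` is either exact off its odd hyperplane (round-1 configuration R1, `tw22_levelFive_ge2932_rigid`) or in configuration (c)
(`±2` on a 256-point subset of the even set).  NO new value of `θ₁₂`; NOT summit progress.  Paper proof: HOME/b2b-cforr-cert-g23/PROOF-N12-928-L5.md §6.

THE ARGUMENT (cases (a), (b): off `P` the residual `e` lies in `16ℤ`, so `l5k_shat` applies: `ŝ(y) = Σ_{x∈P} e(x)(−1)^{x·y} ∈ 1024ℤ`).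
By duality (`l5k_duality`, the partner is at level `≥ 5` by `tw23_ge2932_levelFive`) `ê = −64·e_f ∈ 64ℤ`.  In (b): `ê(0) = ŝ(0) ± 32
≡ 32 (mod 64)` — contradiction (`tw23_levelFive_R2b_false`).  In (a): `ê = ŝ + 16·T`, `T(y) = Σ_{x∈O} η_x(−1)^{x·y} ∈ {0, ±2, ±4}`;
`64 ∣ ê` forces `T ∈ {0, ±4}`, and `Σ_y T² = 4·4096` (orthogonality) gives `#{T ≠ 0} = 1024`; then `e_f = −ŝ/64 − T/4` is odd exactly on
these `1024` points — but the odd set of a level-`≥ 5` partner at `Φ ≥ 29/32` is empty or an affine hyperplane (`2048` points,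
`tw22_oddset_card_ge2932`) (`tw23_levelFive_R2a_false`).  Hence (`tw23_levelFive_ge2932_offP_c`) a level-5 side that is not exact off `P`
is in configuration (c).

References: J. Ax (1964) / R. J. McEliece (1972); MacWilliams–Sloane (1977) Ch. 13–15; R. O'Donnell (2014) §3.3.  Axioms: the standard three.
-/

set_option linter.dupNamespace false -- D-0017: single-problem summit ⇒ `QuantumAdvantage.QuantumAdvantage` by design

noncomputable section

namespace Summit.QuantumAdvantage.QuantumAdvantage.Theorems.CubicForrelation.NearExactIsExact

open Finset
open Literature.Computability.QuantumComplexity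
open Literature.Computability.QuantumComplexity.BuzetChailloux (bxor zeroVec bxor_bxor_cancel_left bxor_zeroVec zeroVec_bxor bxor_comm
  bxor_self twist_zeroVec_right twist_bxor_right)
open Literature.Computability.QuantumComplexity.DerivativeWalsh (W twist_bxor_left)
open Literature.Computability.QuantumComplexity.Simon (twist_eq_one_or)

/-! ### The two kills -/
/-- **Configuration R2(b) is dead**: a level-5 side at `Φ ≥ 29/32` whose residual off the odd set is `±32` at a single point (and `0`
elsewhere off it, `±1` on it) does not exist.  NOT summit progress. [this work] -/
theorem tw23_levelFive_R2b_false (f g : (Fin (6 + 6) → Bool) → Bool) (hf : IsDegLeFun 3 f) (hg : IsDegLeFun 3 g)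
    (u' : (Fin (6 + 6) → Bool) → ℤ) (hu' : ∀ x, W (fun y => signOf (g y)) x = (2 : ℝ) ^ 5 * (u' x : ℝ))
    (hodd : ∃ x, Odd (u' x)) (hΦ : (29 / 32 : ℝ) ≤ forrelation f g)
    (hP1 : ∀ x, Odd (u' x) → (u' x - 2 * sZ (f x)) ^ 2 = 1)
    (x₁ : Fin (6 + 6) → Bool) (hx₁ : ¬ Odd (u' x₁)) (hx₁v : (u' x₁ - 2 * sZ (f x₁)) ^ 2 = 1024)
    (hrest : ∀ x, ¬ Odd (u' x) → x ≠ x₁ → u' x - 2 * sZ (f x) = 0) : False := by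
  classical
  set e : (Fin (6 + 6) → Bool) → ℤ := fun x => u' x - 2 * sZ (f x) with hedef
  have he₁ : e x₁ = 32 ∨ e x₁ = -32 := by
    have : (e x₁ - 32) * (e x₁ + 32) = 0 := by have h : e x₁ ^ 2 = 1024 := hx₁v; nlinarith
    rcases mul_eq_zero.1 this with h | h
    · left; linarith
    · right; linarith
  have hoff8 : ∀ x, ¬ Odd (u' x) → (8 : ℤ) ∣ e x := by
    intro x hx
    by_cases hxx : x = x₁
    · subst hxx; rcases he₁ with h | h
      · exact ⟨4, by rw [h]; norm_num⟩
      · exact ⟨-4, by rw [h]; norm_num⟩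
    · have h0 : e x = 0 := hrest x hx hxx
      rw [h0]; exact dvd_zero _
  -- the partner is at level ≥ 5
  obtain ⟨uf, huf⟩ := (tw23_ge2932_levelFive f g hf hg hΦ).2
  -- `ê(0) = ŝ(0) + e(x₁)` and `ê(0) = −64 e_f(0)`
  obtain ⟨k, hk⟩ := l5k_shat f g hf hg u' hu' hodd hΦ hP1 hoff8 zeroVec
  have hdual := l5k_duality f g u' hu' uf huf zeroVec
  set P := univ.filter (fun x : Fin (6 + 6) → Bool => Odd (u' x)) with hPdef
  set P' := univ.filter (fun x : Fin (6 + 6) → Bool => ¬ Odd (u' x)) with hP'def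
  have hsplit : ∑ a, ((e a : ℤ) : ℝ) * twist a zeroVec =
      ∑ a ∈ P, ((e a : ℤ) : ℝ) * twist a zeroVec + ∑ a ∈ P', ((e a : ℤ) : ℝ) * twist a zeroVec :=
    (sum_filter_add_sum_filter_not univ (fun x => Odd (u' x)) _).symm
  have hP'sum : ∑ a ∈ P', ((e a : ℤ) : ℝ) * twist a zeroVec = (e x₁ : ℝ) := by
    rw [sum_eq_single_of_mem x₁ (mem_filter.2 ⟨mem_univ _, hx₁⟩) (fun x hx hxx => by
      rw [show e x = 0 from hrest x (mem_filter.1 hx).2 hxx]; simp)]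
    rw [twist_zeroVec_right, mul_one]
  change ∑ a, ((e a : ℤ) : ℝ) * twist a zeroVec = -64 * (((uf zeroVec - 2 * sZ (g zeroVec) : ℤ) : ℝ)) at hdual
  change ∑ x ∈ P, ((e x : ℤ) : ℝ) * twist x zeroVec = 1024 * (k : ℝ) at hk
  rw [hsplit, hk, hP'sum] at hdual
  -- `1024k + e(x₁) = −64 e_f(0)` with `e(x₁) = ±32`: impossible
  have hZ : (1024 * k + e x₁ : ℤ) = -64 * (uf zeroVec - 2 * sZ (g zeroVec)) := by exact_mod_cast hdual
  rcases he₁ with h | h <;> rw [h] at hZ <;> omega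

/-- **Configuration R2(a) is dead**: a level-5 side at `Φ ≥ 29/32` whose residual off the odd set is `±16` on a 4-point set `O`
(and `0` elsewhere off it, `±1` on it) does not exist.  NOT summit progress. [this work] -/
theorem tw23_levelFive_R2a_false (f g : (Fin (6 + 6) → Bool) → Bool) (hf : IsDegLeFun 3 f) (hg : IsDegLeFun 3 g)
    (u' : (Fin (6 + 6) → Bool) → ℤ) (hu' : ∀ x, W (fun y => signOf (g y)) x = (2 : ℝ) ^ 5 * (u' x : ℝ))
    (hodd : ∃ x, Odd (u' x)) (hΦ : (29 / 32 : ℝ) ≤ forrelation f g)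
    (hP1 : ∀ x, Odd (u' x) → (u' x - 2 * sZ (f x)) ^ 2 = 1)
    (O : Finset (Fin (6 + 6) → Bool)) (hO : #O = 4) (hOv : ∀ x ∈ O, ¬ Odd (u' x) ∧ (u' x - 2 * sZ (f x)) ^ 2 = 256)
    (hrest : ∀ x, ¬ Odd (u' x) → x ∉ O → u' x - 2 * sZ (f x) = 0) : False := by
  classical
  set e : (Fin (6 + 6) → Bool) → ℤ := fun x => u' x - 2 * sZ (f x) with hedef
  have hOval : ∀ x ∈ O, e x = 16 ∨ e x = -16 := by
    intro x hx
    have : (e x - 16) * (e x + 16) = 0 := by have h : e x ^ 2 = 256 := (hOv x hx).2; nlinarith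
    rcases mul_eq_zero.1 this with h | h
    · left; linarith
    · right; linarith
  have hoff8 : ∀ x, ¬ Odd (u' x) → (8 : ℤ) ∣ e x := by
    intro x hx
    by_cases hxO : x ∈ O
    · rcases hOval x hxO with h | h
      · exact ⟨2, by rw [h]; norm_num⟩
      · exact ⟨-2, by rw [h]; norm_num⟩
    · have h0 : e x = 0 := hrest x hx hxO
      rw [h0]; exact dvd_zero _
  obtain ⟨uf, huf⟩ := (tw23_ge2932_levelFive f g hf hg hΦ).2
  set P := univ.filter (fun x : Fin (6 + 6) → Bool => Odd (u' x)) with hPdef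
  set P' := univ.filter (fun x : Fin (6 + 6) → Bool => ¬ Odd (u' x)) with hP'def
  -- `T(y) = Σ_{x∈O} η_x (−1)^{x·y}` with `η = e/16`
  set η : (Fin (6 + 6) → Bool) → ℝ := fun x => (e x : ℝ) / 16 with hηdef
  have hηpm : ∀ x ∈ O, η x = 1 ∨ η x = -1 := by
    intro x hx
    simp only [η]
    rcases hOval x hx with h | h
    · left; rw [show ((e x : ℤ) : ℝ) = 16 by exact_mod_cast h]; norm_num
    · right; rw [show ((e x : ℤ) : ℝ) = -16 by exact_mod_cast h]; norm_num
  set T : (Fin (6 + 6) → Bool) → ℝ := fun y => ∑ x ∈ O, η x * twist x y with hTdef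
  -- `ê(y) = ŝ(y) + 16 T(y) = −64 e_f(y)`
  have hkey : ∀ y, ∃ k : ℤ, -64 * (((uf y - 2 * sZ (g y) : ℤ) : ℝ)) = 1024 * (k : ℝ) + 16 * T y := by
    intro y
    obtain ⟨k, hk⟩ := l5k_shat f g hf hg u' hu' hodd hΦ hP1 hoff8 y
    have hdual := l5k_duality f g u' hu' uf huf y
    have hsplit : ∑ a, ((e a : ℤ) : ℝ) * twist a y =
        ∑ a ∈ P, ((e a : ℤ) : ℝ) * twist a y + ∑ a ∈ P', ((e a : ℤ) : ℝ) * twist a y :=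
      (sum_filter_add_sum_filter_not univ (fun x => Odd (u' x)) _).symm
    have hOsub : O ⊆ P' := fun x hx => mem_filter.2 ⟨mem_univ _, (hOv x hx).1⟩
    have hP'sum : ∑ a ∈ P', ((e a : ℤ) : ℝ) * twist a y = 16 * T y := by
      rw [← sum_subset hOsub (fun x hx hxO => by
        rw [show e x = 0 from hrest x (mem_filter.1 hx).2 hxO]; simp)]
      simp only [T, η]
      rw [mul_sum]
      exact sum_congr rfl fun x _ => by ring
    change ∑ a, ((e a : ℤ) : ℝ) * twist a y = -64 * (((uf y - 2 * sZ (g y) : ℤ) : ℝ)) at hdual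
    change ∑ x ∈ P, ((e x : ℤ) : ℝ) * twist x y = 1024 * (k : ℝ) at hk
    rw [hsplit, hk, hP'sum] at hdual
    exact ⟨k, hdual.symm⟩
  -- `T(y)` is an integer in `{0, ±2, ±4}` … and `64 ∣ 16 T` forces `T ∈ {0, ±4}`; we only need: `T(y) ≠ 0 ↔ e_f(y) odd`, `T² ≤ 16`,
  -- and `T ≠ 0 ⇒ T² = 16`.
  -- `T(y) = 4j` with `j ∈ {−1, 0, 1}`, and `uf(y)` is odd iff `j ≠ 0`
  have hTbound : ∀ y, -4 ≤ T y ∧ T y ≤ 4 := by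
    intro y
    have hle : ∀ x ∈ O, η x * twist x y ≤ 1 := by
      intro x hx
      rcases hηpm x hx with h | h <;> rcases twist_eq_one_or x y with h' | h' <;> rw [h, h'] <;> norm_num
    have hge : ∀ x ∈ O, -1 ≤ η x * twist x y := by
      intro x hx
      rcases hηpm x hx with h | h <;> rcases twist_eq_one_or x y with h' | h' <;> rw [h, h'] <;> norm_num
    have h1 := sum_le_sum hle
    have h2 := sum_le_sum hge
    rw [sum_const, hO] at h1 h2
    simp only [T]
    norm_num at h1 h2
    exact ⟨by linarith, by linarith⟩
  have hvals : ∀ y, ∃ j : ℤ, T y = 4 * (j : ℝ) ∧ (j = -1 ∨ j = 0 ∨ j = 1) ∧ (Odd (uf y) ↔ j ≠ 0) := by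
    intro y
    obtain ⟨k, hk⟩ := hkey y
    obtain ⟨s, hs, hsv⟩ : ∃ s : ℤ, (s = 1 ∨ s = -1) ∧ sZ (g y) = s := ⟨sZ (g y), tp_sZ_cases _, rfl⟩
    rw [hsv] at hk
    have hTj : T y = 4 * (((-(uf y - 2 * s) - 16 * k : ℤ)) : ℝ) := by push_cast at hk ⊢; linarith
    have hj3 : (-(uf y - 2 * s) - 16 * k : ℤ) = -1 ∨ (-(uf y - 2 * s) - 16 * k : ℤ) = 0 ∨
        (-(uf y - 2 * s) - 16 * k : ℤ) = 1 := by
      obtain ⟨hlo, hhi⟩ := hTbound y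
      rw [hTj] at hlo hhi
      have h1 : (-1 : ℝ) ≤ ((-(uf y - 2 * s) - 16 * k : ℤ) : ℝ) := by linarith
      have h2 : (((-(uf y - 2 * s) - 16 * k : ℤ)) : ℝ) ≤ 1 := by linarith
      have h1' : (-1 : ℤ) ≤ -(uf y - 2 * s) - 16 * k := by exact_mod_cast h1
      have h2' : -(uf y - 2 * s) - 16 * k ≤ 1 := by exact_mod_cast h2
      omega
    refine ⟨-(uf y - 2 * s) - 16 * k, hTj, hj3, ?_⟩
    rw [Int.odd_iff]
    constructor
    · intro ho h0
      rcases hs with h | h <;> rw [h] at h0 <;> omega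
    · intro hne
      rcases hs with h | h <;> rw [h] at hne hj3 <;> omega
  -- `Σ_y T(y)² = 4·4096` by orthogonality of characters
  have horth : ∑ y : Fin (6 + 6) → Bool, T y ^ 2 = 4 * 4096 := by
    have e1 : ∀ y, T y ^ 2 = ∑ x ∈ O, ∑ x' ∈ O, η x * η x' * twist (bxor x x') y := by
      intro y
      simp only [T]
      rw [sq, sum_mul_sum]
      refine sum_congr rfl fun x _ => sum_congr rfl fun x' _ => ?_
      rw [twist_bxor_left]; ring
    rw [sum_congr rfl fun y _ => e1 y, sum_comm]
    have e2 : ∀ x ∈ O, ∑ y : Fin (6 + 6) → Bool, ∑ x' ∈ O, η x * η x' * twist (bxor x x') y = 4096 := by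
      intro x hx
      rw [sum_comm]
      have e3 : ∀ x' ∈ O, ∑ y : Fin (6 + 6) → Bool, η x * η x' * twist (bxor x x') y =
          η x * η x' * (if bxor x x' = (fun _ => false) then (2 : ℝ) ^ (6 + 6) else 0) := by
        intro x' _
        rw [← mul_sum, Simon.sum_twist]
      rw [sum_congr rfl e3]
      rw [sum_eq_single_of_mem x hx (fun x' _ hxx' => by
        rw [if_neg (fun h => hxx' ?_), mul_zero]
        have := congrArg (bxor x) h
        rw [bxor_bxor_cancel_left] at this
        rw [this]; exact bxor_zeroVec x)]
      rw [if_pos (show bxor x x = (fun _ => false) from bxor_self x)]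
      rcases hηpm x hx with h | h <;> rw [h] <;> norm_num
    rw [sum_congr rfl e2, sum_const, hO]
    norm_num
  -- hence exactly `1024` characters `y` have `T(y) ≠ 0`, i.e. `uf(y)` odd
  have hcount : #(univ.filter fun y : Fin (6 + 6) → Bool => Odd (uf y)) = 1024 := by
    have e1 : ∀ y, T y ^ 2 = if Odd (uf y) then (16 : ℝ) else 0 := by
      intro y
      obtain ⟨j, hj, hj3, hiff⟩ := hvals y
      rw [hj]
      by_cases hy : Odd (uf y)
      · rw [if_pos hy]
        have hj0 : j ≠ 0 := hiff.1 hy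
        rcases hj3 with h | h | h
        · rw [h]; norm_num
        · exact absurd h hj0
        · rw [h]; norm_num
      · rw [if_neg hy]
        have : j = 0 := by by_contra h; exact hy (hiff.2 h)
        rw [this]; norm_num
    have h := horth
    rw [sum_congr rfl fun y _ => e1 y, ← sum_filter, sum_const, nsmul_eq_mul] at h
    have : (#(univ.filter fun y : Fin (6 + 6) → Bool => Odd (uf y)) : ℝ) = 1024 := by linarith
    exact_mod_cast this
  -- but the odd set of the partner is empty or has `2048` points
  have hΦ' : (29 / 32 : ℝ) ≤ forrelation g f := by
    rw [Summit.QuantumAdvantage.QuantumAdvantage.Theorems.SignedCubicForrelationNotPrBPP.Negative.HalfQuad.forrelation_comm]; exact hΦ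
  by_cases hex : ∃ y, Odd (uf y)
  · have h2048 := tw22_oddset_card_ge2932 g f hf uf huf hex hΦ'
    rw [hcount] at h2048
    norm_num at h2048
  · push Not at hex
    have h0 : #(univ.filter fun y : Fin (6 + 6) → Bool => Odd (uf y)) = 0 :=
      card_eq_zero.2 (filter_eq_empty_iff.2 fun y _ => hex y)
    rw [hcount] at h0
    norm_num at h0

/-- **A level-5 side at `Φ ≥ 29/32` that is not exact off its odd hyperplane is in configuration (c)**: `e/2` is odd somewhere off the odd
set (and then `l5t_layer2` describes it: `±2` on a 256-point subset with even 4-flat sections, `±1` on the odd set).  NOT summit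
progress. [this work] -/
theorem tw23_levelFive_ge2932_offP_c (f g : (Fin (6 + 6) → Bool) → Bool) (hf : IsDegLeFun 3 f) (hg : IsDegLeFun 3 g)
    (u' : (Fin (6 + 6) → Bool) → ℤ) (hu' : ∀ x, W (fun y => signOf (g y)) x = (2 : ℝ) ^ 5 * (u' x : ℝ))
    (hodd : ∃ x, Odd (u' x)) (hΦ : (29 / 32 : ℝ) ≤ forrelation f g)
    (hne : ∃ y, ¬ Odd (u' y) ∧ u' y ≠ 2 * sZ (f y)) :
    ∃ x, ¬ Odd (u' x) ∧ Odd ((u' x - 2 * sZ (f x)) / 2) := by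
  obtain ⟨hP1, h⟩ := tw23_levelFive_ge2932_offP f g hf hg u' hu' hodd hΦ hne
  rcases h with ⟨O, hO, hOv, hrest⟩ | ⟨x₁, hx₁, hx₁v, hrest⟩ | hc
  · exact (tw23_levelFive_R2a_false f g hf hg u' hu' hodd hΦ hP1 O hO hOv hrest).elim
  · exact (tw23_levelFive_R2b_false f g hf hg u' hu' hodd hΦ hP1 x₁ hx₁ hx₁v hrest).elim
  · exact hc

end Summit.QuantumAdvantage.QuantumAdvantage.Theorems.CubicForrelation.NearExactIsExact

end
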